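import Summits.QuantumFields.YangMills.Theorems.UnitScaleTiltProp7TrueLinDefectBound
import HarnessLib

/-!
# Route `UnitScaleTilt`, crux K1 «MinimiserStabilityRegPr» (stmt-QuantumFields-19200), route-R [RP] curved, the curved N6 row (R-C), third brick —
# THE `k`-FOLD PROPAGATION: THE REDUCED ITERATE `G_k` IS THE PURE `LINE`-ITERATE `S_k` UP TO AN `ℓ²`-DEFECT
# `ρ·‖G_k − S_k‖_{ℓ²} ≤ ρ^k·κ·(Σ_{j<k} α_j)·exp((κ∕ρ)·Σ_{j<k} α_j)·‖Y‖_{ℓ²}`, `ρ = L^{(2−d)/2}` (`= L^{−1/2}` at d = 3), k-UNIFORM once `Σ_j α_j = O(ε)` (geometric tower)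

Cell `ym3-torus`, width seat `ym-ust-20520-w2` (g3); sequel of ✓ p606268 `…TrueLinIterStructure` (`T^{(k)}Y = G_k + P_{Ū₀^{(k)}}Λ_k`), ✓ p606243 `…TrueLinReducedStep`,
✓ p606827 `…TrueLinLineBound` (`Σ_c‖LINE Z(c)‖² ≤ L^{2−d}Σ‖Z‖²`) and ⧗ `…TrueLinDefectBound` (`Σ_c‖D_j(c)‖² ≤ (159(d+2)Lα_j)²(2dL^d)(2d)Σ‖G_j‖²`).  THEOREMS ONLY
(0 `def`, 0 `sorry`); `--supports stmt-QuantumFields-19200`, count-neutral.  YM₃ on T³ is a ladder rung (R3), not the Clay problem; nothing here claims the curved N6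
bounds in full, S2, P, the crux or the gap.

THE POINT.  With `G_{j+1} = LINE_j(G_j) + D_j` (✓ p606243) and the pure recursion `S_0 = Y`, `S_{j+1} = LINE_j(S_j)` (the comb-transported covariant straight-line means
iterated along the background tower — the object to be compared with the engine's `A^{U₀}` of ✓ p601741 by transport geometry, the last part of (R-C)), linearity of
`LINE_j` gives `G_{j+1} − S_{j+1} = LINE_j(G_j − S_j) + D_j`, so in `ℓ²` (genuine Minkowski — the squared route compounds `2^k`): `δ_{j+1} ≤ ρδ_j + κα_j g_j`,
`g_{j+1} ≤ (ρ + κα_j)g_j`, `ρ = √(L^{2−d})`, `κ = 159(d+2)L·√((2dL^d)(2d))`; the elementary recursion bound (§2) closes it with `exp` of the level sum.  At d = 3 and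
`α_j ≤ C·ε·L^{2(j−k)}`: `‖G_k − S_k‖²_{ℓ²} ≤ (κ'ε)²·L^{1−k}·Σ_b‖Y_b‖²`, i.e. with `E_c := ℓ³‖G_k(c) − S_k(c)‖` exactly the consumer's `Σ_cE_c² ≤ c_E·ℓ⁵ε²Σ‖Y‖²`.

WHAT IS PROVED (ns `…Theorems.Prop7TrueLinIterDefect`).
* §1 `sqrt_sum_norm_add_sq_le` (finite Minkowski in `ℓ²`, via `PiLp 2`), `sqrt_sum_normSq_line_le` (`‖LINE_VZ‖_{ℓ²} ≤ ρ‖Z‖_{ℓ²}`), `sqrt_sum_normSq_defect_le`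
  (`‖D‖_{ℓ²} ≤ κα‖Z‖_{ℓ²}`).
* §2 `recursion_bound` — the real-sequence lemma: `g_{j+1} ≤ (ρ+κa_j)g_j`, `δ_{j+1} ≤ ρδ_j + κa_jg_j`, `δ_0 = 0` ⇒ `g_k ≤ ρ^k e^{(κ/ρ)A_k}g_0`, `ρδ_k ≤ ρ^kκA_ke^{(κ/ρ)A_k}g_0`.
* §3 ★★ `sqrt_sum_normSq_reduced_sub_lineIter_le` — the title, for the recursion families `G` (reduced, `CM :=` covariant comb mean) and `S` (pure `LINE`) along the tower,
  under per-level loop-variable sizes `a j` (`≤ 1/24`, `< δ_N`) — displayed, dischargeable from `PlaqSmall (ε(L^k)⁻²) U₀` (★routeR-w2 g0's `tower_guard`∕`tower_plaq_lt`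
  ∘ `dist1_loopHol_le'`); companion `sqrt_sum_normSq_reduced_le` (`‖G_k‖_{ℓ²} ≤ ρ^k e^{(κ/ρ)A}‖Y‖_{ℓ²}`).
HONEST SCOPE.  The comparison `S_k ↔ A^{U₀}` (engine penalty summand; nested centre-combs + tower transports vs corner `treeWord` combs: lattice Stokes on loops of
perimeter `O(dL^k)` at curvature `εL^{−2k}`) is NOT here — it is the remaining part of row (R-C).

References: T. Bałaban, CMP 95 (1984) 17–40 [Balaban1984PropagatorsI] ((1.18)–(1.20) pp.19–20); CMP 98 (1985) 17–51 [Balaban1985Averaging] (Prop. 3 (124)–(126) p.36).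
-/

noncomputable section

open scoped BigOperators Matrix.Norms.L2Operator

namespace Summit.QuantumFields.YangMills.Theorems.Prop7TrueLinIterDefect

open Literature.MathematicalPhysics.QuantumFieldTheory.Balaban1983to89
open Finset T4Continuum BlockAveraging AveragingRT ExpMeanLog BlockAveragingEMLLinearised BlockAveragingEMLLinearisedBackground BlockAveragingEMLProp2
open Summit.QuantumFields.YangMills.Theorems.Prop7TrueLinLineBound (line_sub sum_normSq_line_le)
open Summit.QuantumFields.YangMills.Theorems.Prop7TrueLinDefectBound (sum_normSq_defect_le)

variable {P : Params} {n : Type*} [Fintype n] [DecidableEq n] [Nonempty n] {j : ℕ}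

/-! ## §1 `ℓ²` letters: finite Minkowski and the one-step rows in square-root form -/

/-- Finite Minkowski in `ℓ²`: `√(Σ‖f i + g i‖²) ≤ √(Σ‖f i‖²) + √(Σ‖g i‖²)` (the triangle inequality of `PiLp 2`). [folklore] -/
theorem sqrt_sum_norm_add_sq_le {ι E : Type*} [Fintype ι] [SeminormedAddCommGroup E] (f g : ι → E) :
    Real.sqrt (∑ i, ‖f i + g i‖ ^ 2) ≤ Real.sqrt (∑ i, ‖f i‖ ^ 2) + Real.sqrt (∑ i, ‖g i‖ ^ 2) := by
  have h := norm_add_le (WithLp.toLp 2 f : PiLp 2 (fun _ : ι => E)) (WithLp.toLp 2 g)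
  rw [← WithLp.toLp_add, PiLp.norm_eq_of_L2, PiLp.norm_eq_of_L2, PiLp.norm_eq_of_L2] at h
  exact h

omit [Fintype n] [DecidableEq n] [Nonempty n] in
/-- `Σ a² ≤ C·Σ b²` with `0 ≤ C` gives `√(Σ a²) ≤ √C·√(Σ b²)`. [folklore] -/
theorem sqrt_le_sqrt_mul_of_sq_le {A B C : ℝ} (hC : 0 ≤ C) (h : A ≤ C * B) : Real.sqrt A ≤ Real.sqrt C * Real.sqrt B := by
  rw [← Real.sqrt_mul hC]
  exact Real.sqrt_le_sqrt h

/-! ## §2 The real-sequence recursion bound -/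

omit [Fintype n] [DecidableEq n] [Nonempty n] in
/-- **THE RECURSION BOUND**: nonnegative `g` and `δ` with `δ 0 = 0`, `g (j+1) ≤ (ρ + κ·a j)·g j`, `δ (j+1) ≤ ρ·δ j + κ·a j·g j` for `j < k` (`ρ > 0`, `κ, a j ≥ 0`) satisfy
`g k ≤ ρ^k·exp((κ/ρ)·Σ_{j<k} a j)·g 0` and `ρ·δ k ≤ ρ^k·κ·(Σ_{j<k} a j)·exp((κ/ρ)·Σ_{j<k} a j)·g 0` (`1 + x ≤ eˣ` per level; no `2^k`). [folklore] -/
theorem recursion_bound {ρ κ : ℝ} (hρ : 0 < ρ) (hκ : 0 ≤ κ) (a g δ : ℕ → ℝ) (ha : ∀ j, 0 ≤ a j) (hg : ∀ j, 0 ≤ g j)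
    (hδ0 : δ 0 = 0) :
    ∀ k : ℕ, (∀ j < k, g (j + 1) ≤ (ρ + κ * a j) * g j) → (∀ j < k, δ (j + 1) ≤ ρ * δ j + κ * a j * g j) →
      g k ≤ ρ ^ k * Real.exp (κ / ρ * ∑ j ∈ Finset.range k, a j) * g 0 ∧
      ρ * δ k ≤ ρ ^ k * κ * (∑ j ∈ Finset.range k, a j) * Real.exp (κ / ρ * ∑ j ∈ Finset.range k, a j) * g 0 := by
  intro k
  induction k with
  | zero =>
    intro _ _
    simp [hδ0]
  | succ k ih =>
    intro hgs hδs
    obtain ⟨ihg, ihδ⟩ := ih (fun j hj => hgs j (Nat.lt_succ_of_lt hj)) (fun j hj => hδs j (Nat.lt_succ_of_lt hj))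
    set A : ℝ := ∑ j ∈ Finset.range k, a j with hA
    have hA' : ∑ j ∈ Finset.range (k + 1), a j = A + a k := Finset.sum_range_succ a k
    have hA0 : 0 ≤ A := Finset.sum_nonneg fun j _ => ha j
    set E : ℝ := Real.exp (κ / ρ * A) with hE
    have hE' : Real.exp (κ / ρ * (A + a k)) = E * Real.exp (κ / ρ * a k) := by rw [mul_add, Real.exp_add]
    have hκρ : 0 ≤ κ / ρ := div_nonneg hκ hρ.le
    -- `ρ + κ a_k ≤ ρ·exp((κ/ρ) a_k)`
    have hstep : ρ + κ * a k ≤ ρ * Real.exp (κ / ρ * a k) := by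
      have h1 : 1 + κ / ρ * a k ≤ Real.exp (κ / ρ * a k) := by linarith [Real.add_one_le_exp (κ / ρ * a k)]
      have h2 : ρ + κ * a k = ρ * (1 + κ / ρ * a k) := by field_simp
      rw [h2]
      exact mul_le_mul_of_nonneg_left h1 hρ.le
    have hEk1 : 1 ≤ Real.exp (κ / ρ * a k) := Real.one_le_exp (mul_nonneg hκρ (ha k))
    have hE0 : 0 ≤ E := (Real.exp_pos _).le
    have hρk : 0 ≤ ρ ^ k := pow_nonneg hρ.le k
    rw [hA', hE']
    constructor
    · -- `g (k+1) ≤ (ρ + κ a_k) g_k ≤ ρ exp(κ a_k/ρ) · ρ^k E g_0`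
      calc g (k + 1) ≤ (ρ + κ * a k) * g k := hgs k (Nat.lt_succ_self k)
        _ ≤ (ρ * Real.exp (κ / ρ * a k)) * (ρ ^ k * E * g 0) :=
            mul_le_mul hstep ihg (hg k) (mul_nonneg hρ.le (Real.exp_pos _).le)
        _ = ρ ^ (k + 1) * (E * Real.exp (κ / ρ * a k)) * g 0 := by ring
    · -- `ρ δ(k+1) ≤ ρ(ρ δ_k) + ρ κ a_k g_k ≤ ρ^{k+1} κ E g_0 (A + a_k) ≤ … · exp(κ a_k/ρ)`
      have h1 : ρ * δ (k + 1) ≤ ρ * (ρ * δ k) + ρ * (κ * a k * g k) := by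
        have := hδs k (Nat.lt_succ_self k)
        nlinarith
      have h2 : ρ * (ρ * δ k) ≤ ρ * (ρ ^ k * κ * A * E * g 0) := mul_le_mul_of_nonneg_left ihδ hρ.le
      have h3 : ρ * (κ * a k * g k) ≤ ρ * (κ * a k * (ρ ^ k * E * g 0)) :=
        mul_le_mul_of_nonneg_left (mul_le_mul_of_nonneg_left ihg (mul_nonneg hκ (ha k))) hρ.le
      have h4 : ρ * (ρ ^ k * κ * A * E * g 0) + ρ * (κ * a k * (ρ ^ k * E * g 0)) = ρ ^ (k + 1) * κ * (A + a k) * E * g 0 := by ring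
      have h5 : ρ ^ (k + 1) * κ * (A + a k) * E * g 0 ≤ ρ ^ (k + 1) * κ * (A + a k) * (E * Real.exp (κ / ρ * a k)) * g 0 := by
        have hc : 0 ≤ ρ ^ (k + 1) * κ * (A + a k) * g 0 := by
          have := ha k; have := hg 0; positivity
        have hEE : E ≤ E * Real.exp (κ / ρ * a k) := le_mul_of_one_le_right hE0 hEk1
        have h6 := mul_le_mul_of_nonneg_left hEE hc
        calc ρ ^ (k + 1) * κ * (A + a k) * E * g 0 = (ρ ^ (k + 1) * κ * (A + a k) * g 0) * E := by ring
          _ ≤ (ρ ^ (k + 1) * κ * (A + a k) * g 0) * (E * Real.exp (κ / ρ * a k)) := h6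
          _ = _ := by ring
      linarith

/-! ## §3 ★★ The `k`-fold `ℓ²` defect of the reduced iterate against the pure `LINE`-iterate -/

/-- ★★ **`G_k` VERSUS THE PURE `LINE`-ITERATE IN `ℓ²`, k-UNIFORMLY.**  Tower `Ū₀^{(j)} = Averaging.iter (blockAvg ℰp) j U₀` in the standing range `k ≤ m + K`; `G` the reduced
recursion family of ✓ p606268 at the covariant comb mean (`hG0`, `hGs`), `S` the pure recursion `S 0 = Y`, `S (j+1) c = LINE_{Ū₀^{(j)}}(S j)(c)` (`hS0`, `hSs`); per-level
loop-variable sizes `dist1(W^{(j)}_i(c)) ≤ a j ≤ 1/24`, `a j < δ_N` (`j < k`).  Then with `ρ = √((L^d)⁻¹L²)` and `κ = 159·(d+2)L·√((2dL^d)(2d))`: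
`ρ·√(Σ_c‖G k c − S k c‖²) ≤ ρ^k·κ·(Σ_{j<k} a j)·exp((κ/ρ)Σ_{j<k} a j)·√(Σ_b‖Y b‖²)` and `√(Σ_c‖G k c‖²) ≤ ρ^k·exp((κ/ρ)Σ_{j<k} a j)·√(Σ_b‖Y b‖²)`.
[cite: Balaban1984PropagatorsI, (1.18)-(1.20) pp.19-20; Balaban1985Averaging, Prop. 3 (124)-(126) p.36] -/
theorem sqrt_sum_normSq_reduced_sub_lineIter_le (U₀ : GaugeField P 0 (Matrix.specialUnitaryGroup n ℂ)) (Y : PBond P 0 → Matrix n n ℂ)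
    (G S : (k : ℕ) → PBond P k → Matrix n n ℂ) (hG0 : ∀ b, G 0 b = Y b) (hS0 : ∀ b, S 0 b = Y b)
    (hGs : ∀ (k : ℕ) (c : PBond P (k + 1)), G (k + 1) c
      = (fderiv ℂ (eml : (Idx P → Matrix n n ℂ) → Matrix n n ℂ)
            (fun i => ((loopHol (Averaging.iter (fun i => blockAvg (P := P) (j := i) (expMeanLogSU (n := n))) k U₀) c i :
              Matrix.specialUnitaryGroup n ℂ) : Matrix n n ℂ))
            (fun i => covWalkSum (Averaging.iter (fun i => blockAvg (P := P) (j := i) (expMeanLogSU (n := n))) k U₀) (G k)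
                (walk (emb c.src) (loopWord P.L c.dir (off i.1) i.2.1 i.2.2))
              * ((loopHol (Averaging.iter (fun i => blockAvg (P := P) (j := i) (expMeanLogSU (n := n))) k U₀) c i :
                Matrix.specialUnitaryGroup n ℂ) : Matrix n n ℂ))
            * star ((corr (expMeanLogSU (n := n)) (Averaging.iter (fun i => blockAvg (P := P) (j := i) (expMeanLogSU (n := n))) k U₀) c :
                Matrix.specialUnitaryGroup n ℂ) : Matrix n n ℂ)
          + ((corr (expMeanLogSU (n := n)) (Averaging.iter (fun i => blockAvg (P := P) (j := i) (expMeanLogSU (n := n))) k U₀) c :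
                Matrix.specialUnitaryGroup n ℂ) : Matrix n n ℂ)
            * covWalkSum (Averaging.iter (fun i => blockAvg (P := P) (j := i) (expMeanLogSU (n := n))) k U₀) (G k)
                (walk (emb c.src) (List.replicate P.L (c.dir, true)))
            * star ((corr (expMeanLogSU (n := n)) (Averaging.iter (fun i => blockAvg (P := P) (j := i) (expMeanLogSU (n := n))) k U₀) c :
                Matrix.specialUnitaryGroup n ℂ) : Matrix n n ℂ))
        - ((((Fintype.card (Idx P) : ℂ))⁻¹ • ∑ i : Idx P,
              covWalkSum (Averaging.iter (fun i => blockAvg (P := P) (j := i) (expMeanLogSU (n := n))) k U₀) (G k) (walk (emb c.src) (stairWord i.2.1 (off i.1))))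
            - ((Averaging.iter (fun i => blockAvg (P := P) (j := i) (expMeanLogSU (n := n))) (k + 1) U₀ c : Matrix.specialUnitaryGroup n ℂ) :
                Matrix n n ℂ)
              * (((Fintype.card (Idx P) : ℂ))⁻¹ • ∑ i : Idx P,
                  covWalkSum (Averaging.iter (fun i => blockAvg (P := P) (j := i) (expMeanLogSU (n := n))) k U₀) (G k) (walk (emb c.tgt) (stairWord i.2.1 (off i.1))))
              * star ((Averaging.iter (fun i => blockAvg (P := P) (j := i) (expMeanLogSU (n := n))) (k + 1) U₀ c :
                Matrix.specialUnitaryGroup n ℂ) : Matrix n n ℂ)))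
    (hSs : ∀ (k : ℕ) (c : PBond P (k + 1)), S (k + 1) c
      = ((Fintype.card (Idx P) : ℂ))⁻¹ • ∑ i : Idx P,
          ((holAt (Averaging.iter (fun i => blockAvg (P := P) (j := i) (expMeanLogSU (n := n))) k U₀) (walk (emb c.src) (stairWord i.2.1 (off i.1))) :
              Matrix.specialUnitaryGroup n ℂ) : Matrix n n ℂ) *
            covWalkSum (Averaging.iter (fun i => blockAvg (P := P) (j := i) (expMeanLogSU (n := n))) k U₀) (S k)
              (walk (walkEnd (emb c.src) (stairWord i.2.1 (off i.1))) (List.replicate P.L (c.dir, true))) *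
          star ((holAt (Averaging.iter (fun i => blockAvg (P := P) (j := i) (expMeanLogSU (n := n))) k U₀) (walk (emb c.src) (stairWord i.2.1 (off i.1))) :
              Matrix.specialUnitaryGroup n ℂ) : Matrix n n ℂ))
    (a : ℕ → ℝ) (ha0 : ∀ j, 0 ≤ a j) {k : ℕ} (hk : k ≤ P.m + P.K)
    (hα : ∀ j < k, ∀ (c : PBond P (j + 1)) (i : Idx P),
        dist1 (loopHol (Averaging.iter (fun i => blockAvg (P := P) (j := i) (expMeanLogSU (n := n))) j U₀) c i) ≤ a j)
    (ha24 : ∀ j < k, a j ≤ 1 / 24) (haN : ∀ j < k, a j < deltaSU n) :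
    Real.sqrt (((P.L : ℝ) ^ P.d)⁻¹ * (P.L : ℝ) ^ 2) * Real.sqrt (∑ c : PBond P k, ‖G k c - S k c‖ ^ 2)
        ≤ Real.sqrt (((P.L : ℝ) ^ P.d)⁻¹ * (P.L : ℝ) ^ 2) ^ k * (159 * (((P.d + 2) * P.L : ℕ) : ℝ) * Real.sqrt (2 * P.d * (P.L : ℝ) ^ P.d * (2 * P.d)))
          * (∑ j ∈ Finset.range k, a j) * Real.exp ((159 * (((P.d + 2) * P.L : ℕ) : ℝ) * Real.sqrt (2 * P.d * (P.L : ℝ) ^ P.d * (2 * P.d)))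
              / Real.sqrt (((P.L : ℝ) ^ P.d)⁻¹ * (P.L : ℝ) ^ 2) * ∑ j ∈ Finset.range k, a j) * Real.sqrt (∑ b : PBond P 0, ‖Y b‖ ^ 2)
      ∧ Real.sqrt (∑ c : PBond P k, ‖G k c‖ ^ 2)
        ≤ Real.sqrt (((P.L : ℝ) ^ P.d)⁻¹ * (P.L : ℝ) ^ 2) ^ k * Real.exp ((159 * (((P.d + 2) * P.L : ℕ) : ℝ) * Real.sqrt (2 * P.d * (P.L : ℝ) ^ P.d * (2 * P.d)))
              / Real.sqrt (((P.L : ℝ) ^ P.d)⁻¹ * (P.L : ℝ) ^ 2) * ∑ j ∈ Finset.range k, a j) * Real.sqrt (∑ b : PBond P 0, ‖Y b‖ ^ 2) := by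
  have hLpos : (0 : ℝ) < (P.L : ℝ) := by exact_mod_cast P.L_pos
  -- letters
  set ρ : ℝ := Real.sqrt (((P.L : ℝ) ^ P.d)⁻¹ * (P.L : ℝ) ^ 2) with hρ
  set κ : ℝ := 159 * (((P.d + 2) * P.L : ℕ) : ℝ) * Real.sqrt (2 * P.d * (P.L : ℝ) ^ P.d * (2 * P.d)) with hκ
  have hcL : (0 : ℝ) < ((P.L : ℝ) ^ P.d)⁻¹ * (P.L : ℝ) ^ 2 := by positivity
  have hρpos : 0 < ρ := Real.sqrt_pos.2 hcL
  have hκ0 : 0 ≤ κ := by positivity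
  have hcD : (0 : ℝ) ≤ 2 * P.d * (P.L : ℝ) ^ P.d * (2 * P.d) := by positivity
  -- the real sequences
  set g : ℕ → ℝ := fun j => Real.sqrt (∑ c : PBond P j, ‖G j c‖ ^ 2) with hg
  set δ : ℕ → ℝ := fun j => Real.sqrt (∑ c : PBond P j, ‖G j c - S j c‖ ^ 2) with hδ
  have hg_nn : ∀ j, 0 ≤ g j := fun j => Real.sqrt_nonneg _
  have hδ0 : δ 0 = 0 := by
    simp only [hδ, hG0, hS0, sub_self, norm_zero]
    simp
  have hg0 : g 0 = Real.sqrt (∑ b : PBond P 0, ‖Y b‖ ^ 2) := by simp only [hg, hG0]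
  -- per-level rows
  have hrows : ∀ j < k, g (j + 1) ≤ (ρ + κ * a j) * g j ∧ δ (j + 1) ≤ ρ * δ j + κ * a j * g j := by
    intro j hj
    have hj1 : j + 1 ≤ P.m + P.K := by omega
    set V := Averaging.iter (fun i => blockAvg (P := P) (j := i) (expMeanLogSU (n := n))) j U₀ with hV
    -- the three level-`j` fields as functions of the coarse bond: defect `D`, `LINE(G j)`, `LINE(G j − S j)`
    set D : PBond P (j + 1) → Matrix n n ℂ := fun c =>
      (fderiv ℂ (eml : (Idx P → Matrix n n ℂ) → Matrix n n ℂ) (fun i => ((loopHol V c i : Matrix.specialUnitaryGroup n ℂ) : Matrix n n ℂ))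
          (fun i => covWalkSum V (G j) (walk (emb c.src) (loopWord P.L c.dir (off i.1) i.2.1 i.2.2))
            * ((loopHol V c i : Matrix.specialUnitaryGroup n ℂ) : Matrix n n ℂ))
          * star ((corr (expMeanLogSU (n := n)) V c : Matrix.specialUnitaryGroup n ℂ) : Matrix n n ℂ)
        + ((corr (expMeanLogSU (n := n)) V c : Matrix.specialUnitaryGroup n ℂ) : Matrix n n ℂ)
          * covWalkSum V (G j) (walk (emb c.src) (List.replicate P.L (c.dir, true)))
          * star ((corr (expMeanLogSU (n := n)) V c : Matrix.specialUnitaryGroup n ℂ) : Matrix n n ℂ))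
      - ((((Fintype.card (Idx P) : ℂ))⁻¹ • ∑ i : Idx P, covWalkSum V (G j) (walk (emb c.src) (stairWord i.2.1 (off i.1))))
          - ((avgFun (expMeanLogSU (n := n)) V c : Matrix.specialUnitaryGroup n ℂ) : Matrix n n ℂ)
              * (((Fintype.card (Idx P) : ℂ))⁻¹ • ∑ i : Idx P, covWalkSum V (G j) (walk (emb c.tgt) (stairWord i.2.1 (off i.1))))
              * star ((avgFun (expMeanLogSU (n := n)) V c : Matrix.specialUnitaryGroup n ℂ) : Matrix n n ℂ))
      - ((Fintype.card (Idx P) : ℂ))⁻¹ • ∑ i : Idx P,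
          ((holAt V (walk (emb c.src) (stairWord i.2.1 (off i.1))) : Matrix.specialUnitaryGroup n ℂ) : Matrix n n ℂ) *
            covWalkSum V (G j) (walk (walkEnd (emb c.src) (stairWord i.2.1 (off i.1))) (List.replicate P.L (c.dir, true))) *
          star ((holAt V (walk (emb c.src) (stairWord i.2.1 (off i.1))) : Matrix.specialUnitaryGroup n ℂ) : Matrix n n ℂ) with hD
    set LG : PBond P (j + 1) → Matrix n n ℂ := fun c => ((Fintype.card (Idx P) : ℂ))⁻¹ • ∑ i : Idx P,
          ((holAt V (walk (emb c.src) (stairWord i.2.1 (off i.1))) : Matrix.specialUnitaryGroup n ℂ) : Matrix n n ℂ) *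
            covWalkSum V (G j) (walk (walkEnd (emb c.src) (stairWord i.2.1 (off i.1))) (List.replicate P.L (c.dir, true))) *
          star ((holAt V (walk (emb c.src) (stairWord i.2.1 (off i.1))) : Matrix.specialUnitaryGroup n ℂ) : Matrix n n ℂ) with hLG
    set LΔ : PBond P (j + 1) → Matrix n n ℂ := fun c => ((Fintype.card (Idx P) : ℂ))⁻¹ • ∑ i : Idx P,
          ((holAt V (walk (emb c.src) (stairWord i.2.1 (off i.1))) : Matrix.specialUnitaryGroup n ℂ) : Matrix n n ℂ) *
            covWalkSum V (G j - S j) (walk (walkEnd (emb c.src) (stairWord i.2.1 (off i.1))) (List.replicate P.L (c.dir, true))) *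
          star ((holAt V (walk (emb c.src) (stairWord i.2.1 (off i.1))) : Matrix.specialUnitaryGroup n ℂ) : Matrix n n ℂ) with hLΔ
    -- the two decompositions `G (j+1) = D + LINE(G j)`, `G (j+1) − S (j+1) = D + LINE(G j − S j)`
    have hiter : Averaging.iter (fun i => blockAvg (P := P) (j := i) (expMeanLogSU (n := n))) (j + 1) U₀ = avgFun (expMeanLogSU (n := n)) V := rfl
    have hdecG : ∀ c, G (j + 1) c = D c + LG c := by
      intro c
      rw [hGs, hiter]
      simp only [hD, hLG]
      abel
    have hdecΔ : ∀ c, G (j + 1) c - S (j + 1) c = D c + LΔ c := by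
      intro c
      rw [hdecG, hSs, hLΔ, hLG, hD]
      simp only [line_sub V (G j) (S j) c]
      abel
    -- the `ℓ²` rows of the pieces
    have hDrow : Real.sqrt (∑ c, ‖D c‖ ^ 2) ≤ κ * a j * g j := by
      have h := sum_normSq_defect_le hj1 V (G j) (hα j hj) (ha24 j hj) (haN j hj)
      have h' : ∑ c, ‖D c‖ ^ 2 ≤ ((159 * a j * (((P.d + 2) * P.L : ℕ) : ℝ)) ^ 2 * (2 * P.d * (P.L : ℝ) ^ P.d * (2 * P.d))) * ∑ b, ‖G j b‖ ^ 2 := by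
        simpa only [hD, mul_assoc] using h
      have h1 := sqrt_le_sqrt_mul_of_sq_le (by positivity) h'
      have h2 : Real.sqrt ((159 * a j * (((P.d + 2) * P.L : ℕ) : ℝ)) ^ 2 * (2 * P.d * (P.L : ℝ) ^ P.d * (2 * P.d))) = κ * a j := by
        rw [Real.sqrt_mul (sq_nonneg _), Real.sqrt_sq (by have := ha0 j; positivity), hκ]
        ring
      rw [h2] at h1
      exact h1
    have hLGrow : Real.sqrt (∑ c, ‖LG c‖ ^ 2) ≤ ρ * g j := by
      have h := sum_normSq_line_le hj1 V (G j)
      exact sqrt_le_sqrt_mul_of_sq_le hcL.le (by simpa only [hLG] using h)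
    have hLΔrow : Real.sqrt (∑ c, ‖LΔ c‖ ^ 2) ≤ ρ * δ j := by
      have h := sum_normSq_line_le hj1 V (G j - S j)
      refine sqrt_le_sqrt_mul_of_sq_le hcL.le ?_
      simpa only [hLΔ, Pi.sub_apply] using h
    constructor
    · calc g (j + 1) = Real.sqrt (∑ c, ‖D c + LG c‖ ^ 2) := by simp only [hg, hdecG]
        _ ≤ Real.sqrt (∑ c, ‖D c‖ ^ 2) + Real.sqrt (∑ c, ‖LG c‖ ^ 2) := sqrt_sum_norm_add_sq_le D LG
        _ ≤ κ * a j * g j + ρ * g j := add_le_add hDrow hLGrow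
        _ = (ρ + κ * a j) * g j := by ring
    · calc δ (j + 1) = Real.sqrt (∑ c, ‖D c + LΔ c‖ ^ 2) := by simp only [hδ, hdecΔ]
        _ ≤ Real.sqrt (∑ c, ‖D c‖ ^ 2) + Real.sqrt (∑ c, ‖LΔ c‖ ^ 2) := sqrt_sum_norm_add_sq_le D LΔ
        _ ≤ κ * a j * g j + ρ * δ j := add_le_add hDrow hLΔrow
        _ = ρ * δ j + κ * a j * g j := by ring
  -- the recursion bound
  have hmain := recursion_bound hρpos hκ0 a g δ ha0 hg_nn hδ0 k (fun j hj => (hrows j hj).1) (fun j hj => (hrows j hj).2)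
  rw [hg0] at hmain
  exact ⟨hmain.2, hmain.1⟩

end Summit.QuantumFields.YangMills.Theorems.Prop7TrueLinIterDefect

end
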